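import Literature.NumberTheory.Transcendental.RoySmallValueHilbert
import HarnessLib

/-!
# Roy's small value estimate for `𝔾ₐ × 𝔾ₘ` — Lemma 5.1 for `m = 2`: `ℂ[X]_{3D} = E₀P ⊕ E₁Q ⊕ E₂R`

Topic `Literature/NumberTheory/Transcendental`. Part of the formalisation of the proof of Roy 2013,
Theorem 1.1 (named fact `roy2013_thm_1_1`, `RoySmallValueEstimates.lean`). Source: D. Roy,
*A small value estimate for `𝔾ₐ × 𝔾ₘ`*, Mathematika 59 (2013) 333–363 = arXiv:1301.0663, §5,
Lemma 5.1 (p. 13 of the arXiv text), in the case `m = 2`, `ν = 3D`: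

> Let `P₀, P₁, P₂` be a regular sequence of `ℂ[X]` contained in `ℂ[X]_D`. Then there exist
> subspaces `E₀, E₁, E₂` of `ℂ[X]_{ν-D}` with `dim E₂ = D²` such that
> `ℂ[X]_ν = E₀P₀ ⊕ E₁P₁ ⊕ E₂P₂`.

As in the printed proof, `E₀ = ℂ[X]_{2D}`, `E₁` is a complement of `(P)_{2D} = P·ℂ[X]_D` in
`ℂ[X]_{2D}` and `E₂` a complement of `(P, Q)_{2D}`; regularity of the sequence `(P, Q, R)` is
taken in the concrete form "`Q` is a non-zero-divisor modulo `(P)`, `R` modulo `(P, Q)`".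
`decompMap D P Q R E₁ E₂ (A₀, A₁, A₂) = A₀P + A₁Q + A₂R`; `lemma_5_1` proves that it is injective
with image `ℂ[X]_{3D}` and that `dim E₂ = D²` (dimension count: `dim E₁ = s(2D) - s(D)`,
`dim E₂ = s(2D) - (2s(D) - 1) = D²`, `s(2D) + dim E₁ + dim E₂ = s(3D)`, `s(n) = binom(n+2,2)`).
The complements can be taken spanned by monomials (`exists_monomial_complement`), which §5
(the determinant `Φ`) uses.

One definition (`decompMap`), everything proved, no new named facts.

## References

* [Roy2013] D. Roy, *A small value estimate for 𝔾ₐ × 𝔾ₘ*, Mathematika 59 (2013), 333–363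
  (arXiv:1301.0663), §5, Lemma 5.1.
-/

noncomputable section

open MvPolynomial Finset Module

namespace Literature.NumberTheory.Transcendental

namespace Roy2013

/-! ### Numerical identities for `s(n) = binom(n+2, 2)` -/

/-- `2 binom(n+2, 2) = (n+2)(n+1)`. [folklore] -/
theorem two_mul_choose_two (n : ℕ) : 2 * (n + 2).choose 2 = (n + 2) * (n + 1) := by
  rw [Nat.choose_two_right, show n + 2 - 1 = n + 1 by omega]
  exact Nat.mul_div_cancel' (even_iff_two_dvd.mp (by
    rw [mul_comm]; exact Nat.even_mul_succ_self (n + 1)))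

/-- `3 s(2D) + 1 = s(3D) + 3 s(D)`. [cite: Roy2013, §5, proof of Lemma 5.1] -/
theorem choose_identity_one (D : ℕ) :
    3 * (2 * D + 2).choose 2 + 1 = (3 * D + 2).choose 2 + 3 * (D + 2).choose 2 := by
  have h1 := two_mul_choose_two (2 * D)
  have h2 := two_mul_choose_two (3 * D)
  have h3 := two_mul_choose_two D
  nlinarith

/-- `s(2D) + 1 = D² + 2 s(D)` (`dim E₂ = D²`). [cite: Roy2013, §5, proof of Lemma 5.1] -/
theorem choose_identity_two (D : ℕ) :
    (2 * D + 2).choose 2 + 1 = D ^ 2 + 2 * (D + 2).choose 2 := by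
  have h1 := two_mul_choose_two (2 * D)
  have h3 := two_mul_choose_two D
  nlinarith

/-! ### The decomposition map -/

/-- The map `(A₀, A₁, A₂) ↦ A₀P + A₁Q + A₂R` on `ℂ[X]_{2D} × E₁ × E₂`.
[cite: Roy2013, §5, Lemma 5.1] -/
def decompMap (D : ℕ) (P Q R : CX) (E₁ E₂ : Submodule ℂ CX) :
    ↥(homogeneousSubmodule (Fin 3) ℂ (2 * D)) × ↥E₁ × ↥E₂ →ₗ[ℂ] CX :=
  ((LinearMap.mulRight ℂ P) ∘ₗ (homogeneousSubmodule (Fin 3) ℂ (2 * D)).subtype).coprod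
    (((LinearMap.mulRight ℂ Q) ∘ₗ E₁.subtype).coprod ((LinearMap.mulRight ℂ R) ∘ₗ E₂.subtype))

/-- `decompMap (A₀, A₁, A₂) = A₀P + A₁Q + A₂R`. [cite: Roy2013, §5, Lemma 5.1] -/
theorem decompMap_apply (D : ℕ) (P Q R : CX) (E₁ E₂ : Submodule ℂ CX)
    (A : ↥(homogeneousSubmodule (Fin 3) ℂ (2 * D)) × ↥E₁ × ↥E₂) :
    decompMap D P Q R E₁ E₂ A = (A.1 : CX) * P + ((A.2.1 : CX) * Q + (A.2.2 : CX) * R) := by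
  simp [decompMap]

/-! ### Lemma 5.1 (`m = 2`, `ν = 3D`) -/

/-- **Roy 2013, Lemma 5.1** for `m = 2`, `ν = 3D`. Let `P, Q, R ∈ ℂ[X]_D` with `P, Q ≠ 0`,
`Q` a non-zero-divisor modulo `(P)` and `R` a non-zero-divisor modulo `(P, Q)`; let
`E₁ ⊆ ℂ[X]_{2D}` be a complement of `P·ℂ[X]_D` and `E₂ ⊆ ℂ[X]_{2D}` a complement of
`P·ℂ[X]_D + Q·ℂ[X]_D`. Then `(A₀, A₁, A₂) ↦ A₀P + A₁Q + A₂R` maps `ℂ[X]_{2D} × E₁ × E₂`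
isomorphically onto `ℂ[X]_{3D}`, and `dim E₂ = D²`. [cite: Roy2013, Lemma 5.1] -/
theorem lemma_5_1 {D : ℕ} {P Q R : CX} (hP : P.IsHomogeneous D) (hQ : Q.IsHomogeneous D)
    (hR : R.IsHomogeneous D) (hP0 : P ≠ 0) (hQ0 : Q ≠ 0)
    (hPQ : ∀ f : CX, Q * f ∈ Ideal.span {P} → f ∈ Ideal.span {P})
    (hPQR : ∀ f : CX, R * f ∈ Ideal.span {P, Q} → f ∈ Ideal.span {P, Q})
    {E₁ E₂ : Submodule ℂ CX} (hE₁ : E₁ ≤ homogeneousSubmodule (Fin 3) ℂ (2 * D))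
    (hE₁i : E₁ ⊓ (homogeneousSubmodule (Fin 3) ℂ D).map (LinearMap.mulLeft ℂ P) = ⊥)
    (hE₁s : E₁ ⊔ (homogeneousSubmodule (Fin 3) ℂ D).map (LinearMap.mulLeft ℂ P) =
      homogeneousSubmodule (Fin 3) ℂ (2 * D))
    (hE₂ : E₂ ≤ homogeneousSubmodule (Fin 3) ℂ (2 * D))
    (hE₂i : E₂ ⊓ ((homogeneousSubmodule (Fin 3) ℂ D).map (LinearMap.mulLeft ℂ P) ⊔
      (homogeneousSubmodule (Fin 3) ℂ D).map (LinearMap.mulLeft ℂ Q)) = ⊥)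
    (hE₂s : E₂ ⊔ ((homogeneousSubmodule (Fin 3) ℂ D).map (LinearMap.mulLeft ℂ P) ⊔
      (homogeneousSubmodule (Fin 3) ℂ D).map (LinearMap.mulLeft ℂ Q)) =
      homogeneousSubmodule (Fin 3) ℂ (2 * D)) :
    LinearMap.ker (decompMap D P Q R E₁ E₂) = ⊥ ∧
      LinearMap.range (decompMap D P Q R E₁ E₂) = homogeneousSubmodule (Fin 3) ℂ (3 * D) ∧
      finrank ℂ E₂ = D ^ 2 := by
  set V : ℕ → Submodule ℂ CX := fun n => homogeneousSubmodule (Fin 3) ℂ n with hV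
  set W₀ : Submodule ℂ CX := (homogeneousSubmodule (Fin 3) ℂ D).map (LinearMap.mulLeft ℂ P) with hW₀
  set W₁ : Submodule ℂ CX := W₀ ⊔ (homogeneousSubmodule (Fin 3) ℂ D).map (LinearMap.mulLeft ℂ Q)
    with hW₁
  haveI hfinV : ∀ n, FiniteDimensional ℂ (homogeneousSubmodule (Fin 3) ℂ n) :=
    finite_homogeneousSubmodule_fin_three
  haveI : FiniteDimensional ℂ E₁ := Submodule.finiteDimensional_of_le hE₁
  haveI : FiniteDimensional ℂ E₂ := Submodule.finiteDimensional_of_le hE₂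
  have hW₀le : W₀ ≤ homogeneousSubmodule (Fin 3) ℂ (2 * D) := by
    rw [hW₀, two_mul]; exact map_mulLeft_le hP D
  have hW₁le : W₁ ≤ homogeneousSubmodule (Fin 3) ℂ (2 * D) := by
    rw [hW₁]; refine sup_le hW₀le ?_
    rw [two_mul]; exact map_mulLeft_le hQ D
  haveI : FiniteDimensional ℂ W₀ := Submodule.finiteDimensional_of_le hW₀le
  haveI : FiniteDimensional ℂ W₁ := Submodule.finiteDimensional_of_le hW₁le
  ----------------------------------------------------------------
  -- dimensions
  ----------------------------------------------------------------
  have hdimW₀ : finrank ℂ W₀ = (D + 2).choose 2 := finrank_map_mulLeft hP0 D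
  have hdimW₁ : finrank ℂ W₁ + 1 = 2 * (D + 2).choose 2 := finrank_map_sup_map hP hQ hP0 hQ0 hPQ
  have hdimE₁ : finrank ℂ E₁ + (D + 2).choose 2 = (2 * D + 2).choose 2 := by
    have h := Submodule.finrank_sup_add_finrank_inf_eq E₁ W₀
    rw [hE₁i, hE₁s, finrank_bot, add_zero, finrank_homogeneousSubmodule_fin_three, hdimW₀] at h
    omega
  have hdimE₂ : finrank ℂ E₂ + finrank ℂ W₁ = (2 * D + 2).choose 2 := by
    have h := Submodule.finrank_sup_add_finrank_inf_eq E₂ W₁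
    rw [hE₂i, hE₂s, finrank_bot, add_zero, finrank_homogeneousSubmodule_fin_three] at h
    omega
  have hE₂D : finrank ℂ E₂ = D ^ 2 := by
    have := choose_identity_two D
    omega
  ----------------------------------------------------------------
  -- the image lies in `ℂ[X]_{3D}`
  ----------------------------------------------------------------
  have hrange : LinearMap.range (decompMap D P Q R E₁ E₂) ≤ homogeneousSubmodule (Fin 3) ℂ (3 * D) := by
    rintro _ ⟨A, rfl⟩
    rw [decompMap_apply]
    have h3 : 3 * D = 2 * D + D := by ring
    rw [h3]
    refine (homogeneousSubmodule (Fin 3) ℂ (2 * D + D)).add_mem (A.1.2.mul hP)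
      ((homogeneousSubmodule (Fin 3) ℂ (2 * D + D)).add_mem ((hE₁ A.2.1.2).mul hQ)
        ((hE₂ A.2.2.2).mul hR))
  ----------------------------------------------------------------
  -- injectivity
  ----------------------------------------------------------------
  have hker : LinearMap.ker (decompMap D P Q R E₁ E₂) = ⊥ := by
    rw [LinearMap.ker_eq_bot']
    rintro ⟨A₀, A₁, A₂⟩ h
    rw [decompMap_apply] at h
    change (A₀ : CX) * P + ((A₁ : CX) * Q + (A₂ : CX) * R) = 0 at h
    -- `A₂ R ∈ (P, Q)` so `A₂ ∈ (P, Q)_{2D} = W₁`, hence `A₂ = 0`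
    have hA₂PQ : (A₂ : CX) ∈ Ideal.span {P, Q} := by
      refine hPQR _ (Ideal.mem_span_pair.mpr ⟨-(A₀ : CX), -(A₁ : CX), ?_⟩)
      linear_combination -h
    have hA₂W : (A₂ : CX) ∈ W₁ := by
      have h2 := mem_sup_of_mem_span_pair hP hQ (by omega : D ≤ 2 * D) (hE₂ A₂.2) hA₂PQ
      rwa [show 2 * D - D = D by omega] at h2
    have hA₂0 : (A₂ : CX) = 0 := by
      have : (A₂ : CX) ∈ E₂ ⊓ W₁ := ⟨A₂.2, hA₂W⟩
      rw [hE₂i] at this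
      exact (Submodule.mem_bot ℂ).mp this
    rw [hA₂0, zero_mul, add_zero] at h
    -- `A₁ Q ∈ (P)` so `A₁ ∈ (P)_{2D} = W₀`, hence `A₁ = 0`
    have hA₁P : (A₁ : CX) ∈ Ideal.span {P} := by
      refine hPQ _ (Ideal.mem_span_singleton'.mpr ⟨-(A₀ : CX), ?_⟩)
      linear_combination -h
    have hA₁W : (A₁ : CX) ∈ W₀ := by
      have h2 := mem_map_mulLeft_of_mem_span_singleton hP (by omega : D ≤ 2 * D) (hE₁ A₁.2) hA₁P
      rwa [show 2 * D - D = D by omega] at h2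
    have hA₁0 : (A₁ : CX) = 0 := by
      have : (A₁ : CX) ∈ E₁ ⊓ W₀ := ⟨A₁.2, hA₁W⟩
      rw [hE₁i] at this
      exact (Submodule.mem_bot ℂ).mp this
    rw [hA₁0, zero_mul, add_zero] at h
    have hA₀0 : (A₀ : CX) = 0 := (mul_eq_zero.mp h).resolve_right hP0
    ext <;> simp [hA₀0, hA₁0, hA₂0]
  ----------------------------------------------------------------
  -- surjectivity by dimension
  ----------------------------------------------------------------
  refine ⟨hker, ?_, hE₂D⟩
  apply Submodule.eq_of_le_of_finrank_eq hrange
  rw [LinearMap.finrank_range_of_inj (LinearMap.ker_eq_bot.mp hker), finrank_prod, finrank_prod,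
    finrank_homogeneousSubmodule_fin_three, finrank_homogeneousSubmodule_fin_three]
  have h1 := choose_identity_one D
  have h2 := choose_identity_two D
  omega

end Roy2013

end Literature.NumberTheory.Transcendental
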